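import Summits.ResolutionOfSingularities.ResolutionOfSingularities.Theorems.WeightedInvariantPlusStalkGameSideCoeff
import Summits.ResolutionOfSingularities.ResolutionOfSingularities.Theorems.WeightedInvariantSuccTHomogeneous
import Summits.ResolutionOfSingularities.ResolutionOfSingularities.Theorems.WeightedInvariantSuccOverCentreRing
import Summits.ResolutionOfSingularities.ResolutionOfSingularities.Theorems.WeightedInvariantHypersurfaceCentreAssemblyExcModel
import Summits.ResolutionOfSingularities.ResolutionOfSingularities.Theorems.AQSHeightTwoPlusStalk
import HarnessLib

/-!
# E2 tier, (S-b2-over): the cobordant local model over the centre — RING-LEVEL ASSEMBLY at a localisation `A'`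

Route `ResolutionOfSingularities/WeightedInvariant`, crux `Theses.WeightedInvariant.HypersurfaceCentreConstruction`
(stmt-ResolutionOfSingularities-19897), door line `local-engine`, E2 tier (S-b2-over) (res-L1-w43-plan-1 SPEC (Δ6b) rev 6, OFFER (o59-b2-over)).

`exists_succOverCentre_model` — the four clauses of `Stage.SuccOverCentreAt` (…ELadderTwoCompatible) at a point `φ_U x` of `B₊` over
`U = Spec A`, for ANY localisation `A'` of `A` at the prime `𝔮` under `x` (in the application: the stalk `𝒪_{Y,y}`) and ANY presentation
`(u, w)` of the localised filtration `𝒥ₙ A' = (u^α : w·α ≥ n)`: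
* the MODEL with the coefficient map (`exists_gameSide_stalk_model_of_plusChartFac_coeff`, …PlusStalkGameSideCoeff): a prime `𝔫` of
  `cobordantAlgebra' u w = A'[t⁻¹, 𝒥ₙ tⁿ]` off the vertex and over `𝔪_{A'}`, `e : (cobordantAlgebra' u w)_𝔫 ≃ 𝒪_{B₊, φ_U x}` compatible with a
  given `σ : A' → 𝒪_{B₊, φ_U x}` extending `σ₊^♯` on `A` (`IsLocalization.ringHom_ext`);
* `t⁻¹ ∈ 𝔫` when all `𝒥ₙ A' ⊆ 𝔪_{A'}`, `n ≥ 1` (`extReesAlgebra.tInv_mem_of_forall_le_comap`);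
* `𝔫` is `t`-HOMOGENEOUS, given chart sections `ρ : ⊕ 𝒥ₙ(U) tⁿ → Γ(B₊, W')` reading the coefficient map on germs, a `ℤ`-grading of `Γ(B₊, W')` with
  `ρ(a) ∈ Γ₀`, `ρ(t⁻¹) ∈ Γ₋₁`, and the prime of `φ_U x` in `Γ(B₊, W')` homogeneous (…SuccTHomogeneous);
* the LOCAL EQUATION `f = (t⁻¹)ᵃ g`, `t⁻¹ ∤ g`, `e (g/1) ~ γ'` for `X(U) A' = (f)`, `X'_{φ_U x} = (γ')`, given a positively weighted family `v ⊆ 𝔪_{A'}`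
  with independent differentials presenting the same filtration (…SuccOverCentreRing; K4-E (I); the saturation kit of …CentreAssemblyExcModel).
Def-free; OURS bookkeeping; nothing here is a claim about Hironaka's problem; AI-written, weaker than expert review.
[cite: Wlodarczyk2022, Def. 5.1.1; 3.3.12; §2.3.9]
-/

noncomputable section

set_option linter.dupNamespace false -- mandated namespace of this single-conjunct summit

open CategoryTheory AlgebraicGeometry TopologicalSpace IsLocalRing
open scoped LaurentPolynomial
open LaurentPolynomial
open Literature.AlgebraicGeometry.Resolution
open Summit.ResolutionOfSingularities.ResolutionOfSingularities.Theorems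

namespace Summit.ResolutionOfSingularities.ResolutionOfSingularities.Cruxes.HypersurfaceCentreConstruction.LocalEngine

section Saturation

variable {A' : Type} [CommRing A'] {I' : ℕ → Ideal A'}

/-- **The `t⁻¹`-saturation of `J · A'[t⁻¹, I'ₙ tⁿ]`, localised at a prime, is the localised strict transform** — the right-hand side of
K4-E (I) (`exists_gameSide_stalk_model_of_plusChartFac_coeff`, …PlusStalkGameSideCoeff), spelled exactly as there, rewritten through
`map_iSup_colon_pow_eq` (…CentreAssemblyExcModel) and `extReesAlgebra.mem_strictTransform_iff`. [cite: Wlodarczyk2022, 3.3.12] -/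
theorem iSup_colon_map_localization_eq (𝔫' : Ideal (extReesAlgebra I')) [𝔫'.IsPrime] (J : Ideal A') :
    (⨆ n : ℕ, ((J.map (algebraMap A' (extReesAlgebra I'))).map
        (algebraMap (extReesAlgebra I') (Localization.AtPrime 𝔫'))).colon
        {algebraMap (extReesAlgebra I') (Localization.AtPrime 𝔫') (extReesAlgebra.tInv I') ^ n}) =
      (extReesAlgebra.strictTransform I' J).map (algebraMap (extReesAlgebra I') (Localization.AtPrime 𝔫')) := by
  have hst : extReesAlgebra.strictTransform I' J =
      ⨆ n : ℕ, (J.map (algebraMap A' (extReesAlgebra I'))).colon {extReesAlgebra.tInv I' ^ n} := by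
    ext g
    rw [extReesAlgebra.mem_strictTransform_iff, mem_iSup_colon_pow_iff]
  rw [hst, map_iSup_colon_pow_eq 𝔫' (Localization.AtPrime 𝔫')]

end Saturation

variable {Y : Scheme.{0}} (R' : ReesFiltration Y) (U : Y.affineOpens)
  (φ : (R'.plusChart U : Scheme.{0}) ⟶ (R'.plus : Scheme.{0}))
  (hφ : φ ≫ R'.plus.ι = (R'.plusChart U).ι ≫ R'.openCover.f ⟨U.1, U.2⟩)

include hφ

set_option maxHeartbeats 800000 in -- instance paths: the K4-E package's `(extReesAlgebra I')_𝔫'` against the presentation `cobordantAlgebra' u w`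
/-- **The cobordant local model over the centre, at a localisation `A'` and a presentation `(u, w)`.**  See the module docstring: the four clauses
of `Stage.SuccOverCentreAt` with `𝒪_{Y,y}` replaced by a localisation `A'` of `Γ(Y, U)` at the prime under `x`, the stalk map by a ring map
`σ : A' → 𝒪_{B₊, φ_U x}` extending `σ₊^♯`, and the local generators by `f`, `γ'`. [cite: Wlodarczyk2022, Def. 5.1.1; 3.3.12; §2.3.9] -/
theorem exists_succOverCentre_model [IsLocallyNoetherian R'.cobordantBlowup] [IsOpenImmersion φ]
    (x : (R'.plusChart U : Scheme.{0})) (q : PrimeSpectrum (R'.sectionsRing U)) (hq : (R'.plusChart U).ι x = q)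
    (hy : R'.πPlus (φ x) ∈ (U : Y.Opens))
    (𝔮 : Ideal Γ(Y, U)) [𝔮.IsPrime] (h𝔮 : q.asIdeal.comap (algebraMap Γ(Y, U) (R'.sectionsRing U)) = 𝔮)
    {A' : Type} [CommRing A'] [IsRegularLocalRing A'] [Algebra Γ(Y, U) A'] [IsLocalization.AtPrime A' 𝔮]
    {n : ℕ} (u : Fin n → A') (w : Fin n → ℕ)
    (hI' : ∀ m, weightedMonomialIdeal u w m = ((R'.ideal m).ideal U).map (algebraMap Γ(Y, U) A'))
    [IsDomain ((R'.plus : Scheme.{0}).presheaf.stalk (φ x))]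
    -- chart sections over `W' ∋ φ_U x` reading the chart, graded, with the prime of `φ_U x` homogeneous
    (W' : (R'.plus : Scheme.{0}).Opens) (hxW' : φ x ∈ W') (ρs : R'.sectionsRing U →+* Γ(R'.plus, W'))
    (hρg : ∀ z : R'.sectionsRing U, φ.stalkMap x ((R'.plus : Scheme.{0}).presheaf.germ W' (φ x) hxW' (ρs z)) =
      (R'.plusChart U).ι.stalkMap x (StructureSheaf.toStalk (R'.sectionsRing U) ((R'.plusChart U).ι x) z))
    (ℬ : ℤ → AddSubgroup Γ(R'.plus, W')) [GradedRing ℬ]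
    (hρC : ∀ a : Γ(Y, U), ρs (algebraMap Γ(Y, U) (R'.sectionsRing U) a) ∈ ℬ 0)
    (hρT : ρs ⟨T (-1), (R'.filtration U).T_neg_one_mem_extendedRees⟩ ∈ ℬ (-1))
    {P : Ideal Γ(R'.plus, W')} (hP : P.IsHomogeneous ℬ)
    (hPg : P = (maximalIdeal _).comap ((R'.plus : Scheme.{0}).presheaf.germ W' (φ x) hxW').hom)
    -- `y ∈ supp`: all pieces in `𝔪`
    (hsupp : ∀ m, 0 < m → weightedMonomialIdeal u w m ≤ maximalIdeal A')
    -- the chart of the centre: a positively weighted family with independent differentials presenting the same filtration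
    {m₁ : ℕ} (v : Fin m₁ → A') (w₁ : Fin m₁ → ℕ) (hpos : ∀ j, 0 < w₁ j) (hv : ∀ j, v j ∈ maximalIdeal A')
    (hli : LinearIndependent (ResidueField A') fun j => (maximalIdeal A').toCotangent ⟨v j, hv j⟩)
    (huv : ∀ m, weightedMonomialIdeal u w m = weightedMonomialIdeal v w₁ m)
    -- the local generators
    (K : Y.IdealSheafData) (f : A') (hf : f ≠ 0) (hXU : (K.ideal U).map (algebraMap Γ(Y, U) A') = Ideal.span {f})
    (γ' : (R'.plus : Scheme.{0}).presheaf.stalk (φ x)) (hγ' : stalkIdeal (R'.strictTransformPlus K) (φ x) = Ideal.span {γ'})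
    -- the comparison map on `A'`
    (σ : A' →+* (R'.plus : Scheme.{0}).presheaf.stalk (φ x))
    (hσ : ∀ a : Γ(Y, U), σ (algebraMap Γ(Y, U) A' a) =
      (R'.πPlus.stalkMap (φ x)) ((Y.presheaf.germ (U : Y.Opens) (R'.πPlus (φ x)) hy) a)) :
    ∃ (𝔫 : Ideal (cobordantAlgebra' u w)) (_ : 𝔫.IsPrime),
      IsTHomogeneous u w 𝔫 ∧ cobordantT' u w ∈ 𝔫 ∧
      (maximalIdeal A').map (algebraMap _ (cobordantAlgebra' u w)) ≤ 𝔫 ∧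
      ¬ (extReesAlgebra.vertexIdeal (weightedMonomialIdeal u w) ≤ 𝔫) ∧
      ∃ e : Localization.AtPrime 𝔫 ≃+* (R'.plus : Scheme.{0}).presheaf.stalk (φ x),
        (∀ s, e (algebraMap (cobordantAlgebra' u w) (Localization.AtPrime 𝔫)
          (algebraMap _ (cobordantAlgebra' u w) s)) = σ s) ∧
        ∃ (a : ℕ) (g : cobordantAlgebra' u w),
          algebraMap _ (cobordantAlgebra' u w) f = cobordantT' u w ^ a * g ∧
          ¬ (cobordantT' u w ∣ g) ∧ Associated (e (algebraMap _ (Localization.AtPrime 𝔫) g)) γ' := by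
  classical
  haveI : IsDomain A' := isDomain_of_isRegularLocalRing A'
  haveI : IsDomain (cobordantAlgebra' u w) := isDomain_cobordantAlgebra' u w
  -- (A) THE MODEL WITH THE COEFFICIENT MAP
  have hmodel := exists_gameSide_stalk_model_of_plusChartFac_coeff R' U φ hφ x q hq hy 𝔮 h𝔮 (I' := weightedMonomialIdeal u w) hI'
  obtain ⟨ℓ, 𝔫', h𝔫', Ψ, hΨI, hV, hM, -, hCa, hZ, -, hsurj, hℓcoe, hℓbase, hℓT⟩ := hmodel
  -- (B) `t⁻¹ ∈ 𝔫'`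
  have hT𝔫 : cobordantT' u w ∈ 𝔫' :=
    extReesAlgebra.tInv_mem_of_forall_le_comap (weightedMonomialIdeal u w) 𝔫'
      (fun m hm a ha => hM (Ideal.mem_map_of_mem _ (hsupp m hm ha))) hV
  -- germs of the chart sections = the model read on the coefficient map
  have hinjφ : Function.Injective (φ.stalkMap x) := (ConcreteCategory.bijective_of_isIso (φ.stalkMap x)).1
  have hlink : ∀ z : R'.sectionsRing U, ((R'.plus : Scheme.{0}).presheaf.germ W' (φ x) hxW').hom (ρs z) =
      Ψ.symm (algebraMap (cobordantAlgebra' u w) (Localization.AtPrime 𝔫') (ℓ z)) := fun z =>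
    hinjφ ((hρg z).trans (hZ z).symm)
  have hlinkΨ : ∀ z : R'.sectionsRing U, Ψ (((R'.plus : Scheme.{0}).presheaf.germ W' (φ x) hxW').hom (ρs z)) =
      algebraMap (cobordantAlgebra' u w) (Localization.AtPrime 𝔫') (ℓ z) := fun z => by
    rw [hlink, RingEquiv.apply_symm_apply]
  have hinjC : Function.Injective (algebraMap (cobordantAlgebra' u w) (Localization.AtPrime 𝔫')) :=
    IsLocalization.injective (Localization.AtPrime 𝔫') (le_nonZeroDivisors_of_noZeroDivisors fun h => (Ideal.mem_primeCompl_iff.mp h) 𝔫'.zero_mem)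
  have hT'0 : cobordantT' u w ≠ 0 := fun h0 =>
    (isUnit_T (R := A') (-1)).ne_zero
      ((extReesAlgebra.coe_tInv (weightedMonomialIdeal u w)).symm.trans (congrArg Subtype.val h0))
  have hT0 : ((R'.plus : Scheme.{0}).presheaf.germ W' (φ x) hxW').hom
      (ρs ⟨T (-1), (R'.filtration U).T_neg_one_mem_extendedRees⟩) ≠ 0 := by
    rw [hlink, hℓT, map_ne_zero_iff _ Ψ.symm.injective, map_ne_zero_iff _ hinjC]
    exact hT'0
  -- (C) `t`-homogeneity
  have hiff : ∀ z' : R'.sectionsRing U, ℓ z' ∈ 𝔫' ↔ ρs z' ∈ P := fun z' => by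
    rw [← IsLocalization.AtPrime.to_map_mem_maximal_iff (Localization.AtPrime 𝔫') 𝔫' (ℓ z'), hPg, Ideal.mem_comap,
      IsLocalRing.mem_maximalIdeal, IsLocalRing.mem_maximalIdeal, mem_nonunits_iff, mem_nonunits_iff, ← hlinkΨ z',
      isUnit_map_iff]
  have h𝔫hom : IsTHomogeneous u w 𝔫' := by
    refine isTHomogeneous_of_forall_single_mem (R'.filtration U) u w ℓ 𝔫' hℓcoe (fun c => ?_) (fun z hz d => ?_)
    · have hc := hsurj c
      obtain ⟨z, m, hm, hzm⟩ := hc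
      refine ⟨z, m, ?_, hzm⟩
      rw [hℓbase]
      exact (IsLocalization.map_units A' (⟨m, hm⟩ : 𝔮.primeCompl)).map _
    · exact (hiff _).mpr (rho_single_mem_of_mem (R'.filtration U) ℬ ρs hρC hρT hP _ _ hPg hT0 ((hiff z).mp hz) d)
  -- (D) the local equation
  have hfac := exists_factor_strictTransform_eq_of_presentation u w v w₁ hpos hv hli huv hf
  obtain ⟨a, g₀, hfg, hndvd, hst⟩ := hfac
  have hsat := hΨI K
  rw [hXU, iSup_colon_map_localization_eq, hst, Ideal.map_span, Set.image_singleton] at hsat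
  have hsat' := congrArg (Ideal.map (Ψ.symm : Localization.AtPrime 𝔫' →+* (R'.plus : Scheme.{0}).presheaf.stalk (φ x))) hsat
  rw [Ideal.map_of_equiv, Ideal.map_span, Set.image_singleton, hγ'] at hsat'
  have hassoc := Ideal.span_singleton_eq_span_singleton.mp hsat'.symm
  -- (A') compatibility with `σ` on all of `A'`
  have hext : (Ψ.symm : Localization.AtPrime 𝔫' →+* (R'.plus : Scheme.{0}).presheaf.stalk (φ x)).comp
      ((algebraMap (cobordantAlgebra' u w) (Localization.AtPrime 𝔫')).comp (algebraMap A' (cobordantAlgebra' u w))) = σ := by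
    refine IsLocalization.ringHom_ext 𝔮.primeCompl (RingHom.ext fun a' => ?_)
    simp only [RingHom.comp_apply, RingHom.coe_coe]
    rw [hσ, RingEquiv.symm_apply_eq]
    exact (hCa a').symm
  exact ⟨𝔫', h𝔫', h𝔫hom, hT𝔫, hM, hV, Ψ.symm, fun s => DFunLike.congr_fun hext s, a, g₀, hfg, hndvd, hassoc⟩

end Summit.ResolutionOfSingularities.ResolutionOfSingularities.Cruxes.HypersurfaceCentreConstruction.LocalEngine

end
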